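import Literature.NumberTheory.IwasawaTheory.CyclotomicTwoTotallyRamifiedOddIndex
import Mathlib.NumberTheory.RamificationInertia.Basic
import HarnessLib

/-!
# The cyclotomic `ℤ₂`-extension of a CUBIC field with one prime of index `2` above `2`: Fukuda's index is `0` from an
# EVEN-INDEX CERTIFICATE — four algebraic integers `u, v, m, m'` of `K` with `u² − 2v² = 4m`, `m² = 2m'`, `8 ∤ N(2 − m'³)`

Topic `Literature/NumberTheory/IwasawaTheory`, namespace `Literature.NumberTheory.IwasawaTheory`.  THEOREMS ONLY (no definition,
no named fact, no instance; D-0026).  Sequel of `CyclotomicTwoTotallyRamifiedOddIndex.lean` (parity: every prime of ODD index above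
`2` ramifies in `K₁ = K(√2)`) for the remaining splitting type `2 = 𝔭²𝔮` of a cubic field, where the prime `𝔭` of index `2` may or
may not ramify in `K(√2)` (it does iff the completion `K_𝔭` is not `ℚ₂(√2)` or `ℚ₂(√10)`; census row `306680s1` of the cell
`bsd-2adic` is a field where it does NOT, Fukuda's index being `1` there).

## What (cell `bsd-2adic`, K4 crux C1″ `FineSelmerConjAAtTwoAdditivePotGood`, stmt-BirchSwinnertonDyer-22615; 19 of the 44 census rows)

* §1 `pow_finrank_mem_span_two_of_forall_mem` — an algebraic integer in every prime above `2` has its `[L:ℚ]`-th power in `2𝓞_L`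
  (counting the normalised prime factors of `2𝓞_L` by absolute norms);
* §2 `four_dvd_ramificationIdx_of_sq_eq_mul` — `θ² = 2`, `x² = θy`, `y ∉ Q ∋ 2` ⟹ `4 ∣ e(Q|2)`; `mem_of_forall_mem_of_mul_eq` —
  descent of «`y` in every prime above `2`» along `y(c − y) = −m'`; `eight_dvd_norm_of_mem_span_two`;
* §3 `ramificationIdx_eq_two_of_four_dvd` — in `K₁/K/ℚ` with `K` cubic, `4 ∣ e(Q|2)` forces `e(w|2) = e(Q|w) = 2` below;
  **`totallyRamifiedFrom_zero_of_evenIndexCertificate`** — the theorem of the title.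

With `CyclotomicTwoTotallyRamifiedOddIndex` this discharges the structural binder `TotallyRamifiedFrom κ 0` of the tree's Fukuda doors
for EVERY cubic field whose primes above `2` are totally ramified in the cyclotomic `ℤ₂`-tower, from finite data.  No elliptic curve
occurs here; BSD is not advanced by this file.

References: [Washington1997] §13.1, Prop. 13.2, Lemma 13.3; [Fukuda1994] p. 264; [NeukirchANT1999] Ch. I §6, §8, §9, Ch. II.
-/

noncomputable section

open scoped NumberField
open Polynomial UniqueFactorizationMonoid NumberField IsDedekindDomain

namespace Literature.NumberTheory.IwasawaTheory

/-! ## §1 An integer in every prime above `2` -/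

section Radical

variable {L : Type*} [Field L] [NumberField L]

omit [NumberField L] in
/-- `x ∈ P` for every `P` in a multiset of ideals ⟹ `x^{#s} ∈ ∏ s`. [folklore] -/
private theorem pow_card_mem_prod_of_forall_mem {x : 𝓞 L} (s : Multiset (Ideal (𝓞 L)))
    (h : ∀ P ∈ s, x ∈ P) : x ^ Multiset.card s ∈ s.prod := by
  induction s using Multiset.induction_on with
  | empty => simp
  | cons P s ih =>
    rw [Multiset.card_cons, pow_succ', Multiset.prod_cons]
    exact Ideal.mul_mem_mul (h P (Multiset.mem_cons_self P s))
      (ih fun Q hQ => h Q (Multiset.mem_cons_of_mem hQ))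

/-- **An algebraic integer lying in every prime above `2` has its `[L:ℚ]`-th power in `2𝓞_L`**: `2𝓞_L = ∏ Qᵢ^{eᵢ}`
with `Σ eᵢ ≤ Σ eᵢ fᵢ = [L:ℚ]` (here: the product of the `#s = Σ eᵢ` normalised prime factors has absolute norm `2^{[L:ℚ]}` and
each factor has norm `≥ 2`), and `x ∈ Qᵢ` for all `i` gives `x^{#s} ∈ ∏ Qᵢ^{eᵢ}`. (The radical of `2𝓞_L` to the power `[L:ℚ]`
lies in `2𝓞_L`.) [cite: NeukirchANT1999, Ch. I §8, Prop. (8.2) and (8.3) (prime factorisation of `p𝓞_L`, `Σ eᵢfᵢ = n`)] -/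
theorem pow_finrank_mem_span_two_of_forall_mem {x : 𝓞 L}
    (h : ∀ P : Ideal (𝓞 L), P.IsPrime → (2 : 𝓞 L) ∈ P → x ∈ P) :
    x ^ Module.finrank ℚ L ∈ Ideal.span {(2 : 𝓞 L)} := by
  classical
  set I : Ideal (𝓞 L) := Ideal.span {(2 : 𝓞 L)} with hI
  have hI0 : I ≠ ⊥ := by simp [hI]
  set s := normalizedFactors I with hs
  have hprod : s.prod = I := by
    have := prod_normalizedFactors hI0
    rwa [associated_iff_eq] at this
  have hmem : ∀ P ∈ s, x ∈ P := by
    intro P hP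
    have hPpr : P.IsPrime := Ideal.isPrime_of_prime (prime_of_normalized_factor P hP)
    have hdvd : P ∣ I := dvd_of_mem_normalizedFactors hP
    exact h P hPpr (Ideal.le_of_dvd hdvd (Ideal.mem_span_singleton_self _))
  have hpow : x ^ Multiset.card s ∈ I := hprod ▸ pow_card_mem_prod_of_forall_mem s hmem
  -- card s ≤ [L:ℚ] : absNorm I = 2^[L:ℚ] and each factor has absNorm ≥ 2
  have hcard : Multiset.card s ≤ Module.finrank ℚ L := by
    have hN : Ideal.absNorm I = 2 ^ Module.finrank ℚ L := by
      rw [hI, Ideal.absNorm_span_singleton]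
      have : (2 : 𝓞 L) = algebraMap ℤ (𝓞 L) 2 := by simp
      rw [this, Algebra.norm_algebraMap, NumberField.RingOfIntegers.rank]
      simp
    have hge : ∀ P ∈ s, 2 ≤ Ideal.absNorm P := by
      intro P hP
      have hPpr : P.IsPrime := Ideal.isPrime_of_prime (prime_of_normalized_factor P hP)
      have hP0 : P ≠ ⊥ := (prime_of_normalized_factor P hP).ne_zero
      have h0 : Ideal.absNorm P ≠ 0 := Ideal.absNorm_eq_zero_iff.not.mpr hP0
      have h1 : Ideal.absNorm P ≠ 1 := by rw [Ne, Ideal.absNorm_eq_one_iff]; exact hPpr.ne_top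
      omega
    have hprodN : (s.map Ideal.absNorm).prod = 2 ^ Module.finrank ℚ L := by
      rw [← hN, ← hprod, map_multiset_prod]
    have hle : 2 ^ Multiset.card s ≤ (s.map Ideal.absNorm).prod := by
      rw [← Multiset.card_map Ideal.absNorm s]
      apply Multiset.pow_card_le_prod
      intro n hn
      obtain ⟨P, hP, rfl⟩ := Multiset.mem_map.mp hn
      exact hge P hP
    rw [hprodN] at hle
    exact (Nat.pow_le_pow_iff_right (by norm_num)).mp hle
  obtain ⟨d, hd⟩ := Nat.exists_eq_add_of_le hcard
  rw [hd, pow_add]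
  exact Ideal.mul_mem_right _ _ hpow

end Radical

/-! ## §2 The local form of the certificate and its descent -/

section Certificate

variable {L : Type*} [Field L] [NumberField L]

/-- **The even-index certificate, local form.** If `θ² = 2` and `x² = θ·y` in `𝓞 L`, and `Q ∋ 2` is a prime of `𝓞 L`
with `y ∉ Q`, then `4 ∣ e(Q|2)`: in the factorisation of `2𝓞_L = (θ)²` the exponent of `Q` is `2·v_Q(θ) = 2·(2 v_Q(x) − v_Q(y))
= 4 v_Q(x)`. [cite: NeukirchANT1999, Ch. I §8, Prop. (8.2) (exponents in the prime factorisation)] -/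
theorem four_dvd_ramificationIdx_of_sq_eq_mul {θ x y : 𝓞 L} (hθ : θ ^ 2 = 2) (hx : x ^ 2 = θ * y)
    (Q : Ideal (𝓞 L)) [hQ : Q.IsPrime] (h2 : (2 : 𝓞 L) ∈ Q) (hy : y ∉ Q) :
    4 ∣ Q.ramificationIdx ℤ := by
  classical
  haveI : Q.LiesOver (Ideal.span {(2 : ℤ)}) := by
    rw [Ideal.liesOver_span_iff hQ.ne_top Int.prime_two, map_ofNat]; exact h2
  have hmap : Ideal.map (algebraMap ℤ (𝓞 L)) (Ideal.span {(2 : ℤ)}) = Ideal.span {θ} ^ 2 := by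
    rw [Ideal.map_span, Set.image_singleton, map_ofNat, Ideal.span_singleton_pow, hθ]
  have hp0 : Ideal.map (algebraMap ℤ (𝓞 L)) (Ideal.span {(2 : ℤ)}) ≠ ⊥ :=
    Ideal.map_ne_bot_of_ne_bot (by simp)
  have hθ0 : (Ideal.span {θ} : Ideal (𝓞 L)) ≠ ⊥ := by
    intro h
    rw [hmap, h] at hp0
    exact hp0 (by simp)
  have hy0 : (Ideal.span {y} : Ideal (𝓞 L)) ≠ ⊥ := by
    rw [Ne, Ideal.span_singleton_eq_bot]
    rintro rfl
    exact hy Q.zero_mem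
  have hx0 : (Ideal.span {x} : Ideal (𝓞 L)) ≠ ⊥ := by
    rw [Ne, Ideal.span_singleton_eq_bot]
    intro h
    have : θ * y = 0 := by rw [← hx, h]; ring
    rcases mul_eq_zero.mp this with h' | h'
    · exact hθ0 (Ideal.span_singleton_eq_bot.mpr h')
    · exact hy0 (Ideal.span_singleton_eq_bot.mpr h')
  -- counts of `Q`
  have hcount : Multiset.count Q (normalizedFactors (Ideal.span {θ} : Ideal (𝓞 L))) =
      2 * Multiset.count Q (normalizedFactors (Ideal.span {x} : Ideal (𝓞 L))) := by
    have hsq : (Ideal.span {x} : Ideal (𝓞 L)) ^ 2 = Ideal.span {θ} * Ideal.span {y} := by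
      rw [Ideal.span_singleton_pow, hx, Ideal.span_singleton_mul_span_singleton]
    have hcy : Multiset.count Q (normalizedFactors (Ideal.span {y} : Ideal (𝓞 L))) = 0 := by
      rw [Multiset.count_eq_zero]
      intro hmem
      exact hy (Ideal.le_of_dvd (dvd_of_mem_normalizedFactors hmem) (Ideal.mem_span_singleton_self y))
    have := congrArg (fun I => Multiset.count Q (normalizedFactors I)) hsq
    rw [normalizedFactors_pow, Multiset.count_nsmul, normalizedFactors_mul hθ0 hy0, Multiset.count_add,
      hcy, add_zero] at this
    exact this.symm
  rw [Ideal.IsDedekindDomain.ramificationIdx_eq_normalizedFactors_count (Ideal.span {(2 : ℤ)}) Q hp0, hmap,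
    normalizedFactors_pow, Multiset.count_nsmul, hcount]
  exact ⟨_, by ring⟩

variable {K : Type} [Field K] [NumberField K] [Algebra K L]

omit [NumberField L] [NumberField K] in
/-- **Descent of the radical condition to `K`.** If `y·(c − y) = −m'` in `𝓞 L` with `c, m' ∈ 𝓞 K` and `y` lies in every
prime of `𝓞 L` above `2`, then `m'` lies in every prime of `𝓞 K` above `2` (every prime of `𝓞 K` has a prime of `𝓞 L` above it,
Mathlib `Ideal.primesOver` non-empty). [cite: NeukirchANT1999, Ch. I §8, Prop. (8.1) and §9 (primes above a prime)] -/
theorem mem_of_forall_mem_of_mul_eq {y : 𝓞 L} {c m' : 𝓞 K}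
    (hy : y * (algebraMap (𝓞 K) (𝓞 L) c - y) = -(algebraMap (𝓞 K) (𝓞 L) m'))
    (h : ∀ Q : Ideal (𝓞 L), Q.IsPrime → (2 : 𝓞 L) ∈ Q → y ∈ Q)
    (w : Ideal (𝓞 K)) [hw : w.IsPrime] (hw2 : (2 : 𝓞 K) ∈ w) : m' ∈ w := by
  obtain ⟨⟨Q, hQprime, hQover⟩⟩ := (inferInstance : Nonempty (Ideal.primesOver w (𝓞 L)))
  have h2Q : (2 : 𝓞 L) ∈ Q := by
    have : algebraMap (𝓞 K) (𝓞 L) 2 ∈ Q := by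
      rw [← Ideal.mem_comap, ← Ideal.under_def, ← hQover.over]; exact hw2
    rwa [map_ofNat] at this
  have hyQ := h Q hQprime h2Q
  have hm'Q : algebraMap (𝓞 K) (𝓞 L) m' ∈ Q := by
    rw [← Q.neg_mem_iff, ← hy]
    exact Q.mul_mem_right _ hyQ
  rw [hQover.over, Ideal.under_def, Ideal.mem_comap]
  exact hm'Q

/-- **`8 ∣ N_{K/ℚ}(z)` for `z ∈ 2𝓞_K`**, `K` a cubic field (`|N(2)| = 2³` divides `|N(z)|`, Mathlib `Ideal.absNorm_dvd_absNorm_of_le`).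
[cite: NeukirchANT1999, Ch. I §6 (norm of an ideal; `𝔞 ⊆ 𝔟 ⇒ N(𝔟) ∣ N(𝔞)`)] -/
theorem eight_dvd_norm_of_mem_span_two (hK : Module.finrank ℚ K = 3) {z : 𝓞 K}
    (hz : z ∈ Ideal.span {(2 : 𝓞 K)}) : (8 : ℤ) ∣ Algebra.norm ℤ z := by
  have hle : Ideal.span {z} ≤ Ideal.span {(2 : 𝓞 K)} := (Ideal.span_singleton_le_iff_mem _).mpr hz
  have hdvd := Ideal.absNorm_dvd_absNorm_of_le hle
  rw [Ideal.absNorm_span_singleton, Ideal.absNorm_span_singleton] at hdvd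
  have h2 : (Algebra.norm ℤ (2 : 𝓞 K)).natAbs = 8 := by
    have : (2 : 𝓞 K) = algebraMap ℤ (𝓞 K) 2 := by simp
    rw [this, Algebra.norm_algebraMap, NumberField.RingOfIntegers.rank, hK]
    norm_num
  rw [h2] at hdvd
  exact Int.natAbs_dvd_natAbs.mp (by simpa using hdvd)

end Certificate

/-! ## §3 The cubic case: Fukuda's index `0` from the certificate -/

section Main

open Literature.NumberTheory.EllipticCurves Literature.NumberTheory.GaloisRepresentations Field

variable {K : Type} [Field K] [NumberField K]

/-- `(2) ⊂ ℤ` is maximal. [folklore] -/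
private theorem isMaximal_span_two : (Ideal.span {(2 : ℤ)}).IsMaximal :=
  Ideal.IsPrime.isMaximal ((Ideal.span_singleton_prime two_ne_zero).mpr Int.prime_two) (by simp)

/-- **In the first layer `K₁ = κ.layer 1` over a CUBIC field `K`, a prime `Q ∋ 2` with `4 ∣ e(Q|2)` lies over a prime `w` of `K`
with `e(w|2) = 2`, and `e(Q|w) = 2`**: `e(Q|2) = e(w|2)·e(Q|w) ≤ 6` (Mathlib `Ideal.ramificationIdx_tower`,
`Ideal.ramificationIdx_le_finrank` with `[K₁:ℚ] = 6`, `[K₁:K] = 2`, `[K:ℚ] = 3`), so `e(Q|2) = 4 = 2·2`.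
[cite: NeukirchANT1999, Ch. I §8, Prop. (8.2) and Ch. II (multiplicativity of `e` in towers)] -/
theorem ramificationIdx_eq_two_of_four_dvd (hK : Module.finrank ℚ K = 3) (κ : ZpExtension K 2)
    (Q : Ideal (𝓞 (κ.layer 1))) [hQ : Q.IsPrime] (h2 : (2 : 𝓞 (κ.layer 1)) ∈ Q)
    (h4 : 4 ∣ Q.ramificationIdx ℤ) : (Q.under (𝓞 K)).ramificationIdx ℤ = 2 ∧ Q.ramificationIdx (𝓞 K) = 2 := by
  haveI : FiniteDimensional K (κ.layer 1) := κ.finiteDimensional_layer_holds 1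
  haveI : NumberField (κ.layer 1) := NumberField.of_module_finite K _
  haveI : NoZeroSMulDivisors (𝓞 K) (𝓞 (κ.layer 1)) := ⟨fun h => smul_eq_zero.mp h⟩
  haveI := isMaximal_span_two
  set w : Ideal (𝓞 K) := Q.under (𝓞 K) with hw
  haveI : Q.LiesOver w := ⟨rfl⟩
  have hw2 : (2 : 𝓞 K) ∈ w := by rw [hw, Ideal.under_def, Ideal.mem_comap, map_ofNat]; exact h2
  have hw0 : w ≠ ⊥ := fun h => by rw [h, Ideal.mem_bot] at hw2; exact two_ne_zero hw2
  haveI : w.IsMaximal := Ideal.IsPrime.isMaximal inferInstance hw0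
  haveI hQ2 : Q.LiesOver (Ideal.span {(2 : ℤ)}) := by
    rw [Ideal.liesOver_span_iff hQ.ne_top Int.prime_two, map_ofNat]; exact h2
  haveI hw2' : w.LiesOver (Ideal.span {(2 : ℤ)}) := by
    rw [Ideal.liesOver_span_iff Ideal.IsPrime.ne_top' Int.prime_two, map_ofNat]; exact hw2
  have h20 : (Ideal.span {(2 : ℤ)} : Ideal ℤ) ≠ ⊥ := by simp
  -- bounds
  have hQ6 : Q.ramificationIdx ℤ ≤ 6 := by
    have h := Ideal.ramificationIdx_le_finrank (𝓞 (κ.layer 1)) ℚ (κ.layer 1) (p := Ideal.span {(2 : ℤ)}) Q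
    rw [Ideal.ramificationIdx'_eq_ramificationIdx _ Q h20] at h
    have hdeg : Module.finrank ℚ (κ.layer 1) = 6 := by
      rw [← Module.finrank_mul_finrank ℚ K (κ.layer 1), hK, κ.finrank_layer_holds 1]; norm_num
    omega
  have hQw : Q.ramificationIdx (𝓞 K) ≤ 2 := by
    have h := Ideal.ramificationIdx_le_finrank (𝓞 (κ.layer 1)) K (κ.layer 1) (p := w) Q
    rw [Ideal.ramificationIdx'_eq_ramificationIdx _ Q hw0, κ.finrank_layer_holds 1, pow_one] at h
    exact h
  have hw3 : w.ramificationIdx ℤ ≤ 3 := by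
    have h := Ideal.ramificationIdx_le_finrank (𝓞 K) ℚ K (p := Ideal.span {(2 : ℤ)}) w
    rw [Ideal.ramificationIdx'_eq_ramificationIdx _ w h20, hK] at h
    exact h
  have htower : Q.ramificationIdx ℤ = w.ramificationIdx ℤ * Q.ramificationIdx (𝓞 K) :=
    Ideal.ramificationIdx_tower w Q
  obtain ⟨c, hc⟩ := h4
  have hc1 : c = 1 := by have := Ideal.ramificationIdx_pos Q ℤ; omega
  subst hc1
  rw [hc] at htower
  -- `a * b = 4`, `a ≤ 3`, `b ≤ 2`
  have key : ∀ a < 4, ∀ b < 3, 4 * 1 = a * b → a = 2 ∧ b = 2 := by decide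
  exact key _ (by omega) _ (by omega) htower

/-- **THE EVEN-INDEX CERTIFICATE: Fukuda's index is `0` for the cyclotomic `ℤ₂`-extension of a cubic field with ONE prime of
ramification index `2` above `2`, from four algebraic integers.**  Let `K` be a cubic number field, `κ` a cyclotomic
`ℤ₂`-extension of `K` (`K₁ = κ.layer 1 = K(√2)`), and `u, v, m, m' ∈ 𝓞_K` with `u² − 2v² = 4m`, `m² = 2m'` and
`8 ∤ N_{K/ℚ}(2 − m'³)`.  Then every prime of `ar ℤ_K` is unramified or totally ramified in `K_∞/K`: `TotallyRamifiedFrom κ 0`.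
Proof: `x = (u + v√2)/2` and `y = x²√2/2 = uv/2 + (u² + 2v²)√2/8` are algebraic integers of `K₁` (roots of `X² − uX + m` and
`X² − uvX − m'`) with `x² = √2·y` and `y(uv − y) = −m'`.  If `y` lay in every prime of `𝓞_{K₁}` above `2`, `m'` would lie in
every prime of `𝓞_K` above `2`, whence `m'³ ∈ 2𝓞_K` (`pow_finrank_mem_span_two_of_forall_mem`) and `8 ∣ N(2 − m'³)` — excluded.
So some prime `Q ∋ 2` of `𝓞_{K₁}` misses `y`; there `e(Q|2) = 4 v_Q(x)` (`four_dvd_ramificationIdx_of_sq_eq_mul`), hence the prime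
`w` of `K` below `Q` has `e(w|2) = 2` and is RAMIFIED in `K₁` (`e(Q|w) = 2`, `ramificationIdx_eq_two_of_four_dvd`); it is the only
prime of `K` above `2` with even index (`Σ e f = 3`, Mathlib `Ideal.sum_ramification_inertia`), the others are ramified in `K₁`
by parity (`not_isUnramifiedIn_layer_one_of_odd_ramificationIdx`), and the first-layer criterion
(`totallyRamifiedFrom_zero_of_forall_not_isUnramifiedIn_layer_one`) concludes.  For a cubic field with `2 = 𝔭²𝔮` and `𝔭`
ramified in `K(√2)` such `u, v` exist (`x` = a uniformiser of the prime above `𝔭` lying in the prime above `𝔮`); they are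
found by a finite search and verified by ring identities — the consumer's business.
[cite: Washington1997, §13.1 Lemma 13.3 (proof) and Prop. 13.2] [cite: Fukuda1994, p. 264 (the index `n₀`)]
[cite: NeukirchANT1999, Ch. I §8, Prop. (8.2)–(8.3)] -/
theorem totallyRamifiedFrom_zero_of_evenIndexCertificate (hK : Module.finrank ℚ K = 3)
    (κ : ZpExtension K 2) (hκ : κ.IsCyclotomic) (u v m m' : 𝓞 K)
    (huv : u ^ 2 - 2 * v ^ 2 = 4 * m) (hm : m ^ 2 = 2 * m')
    (hN : ¬ (8 : ℤ) ∣ Algebra.norm ℤ (2 - m' ^ 3)) : TotallyRamifiedFrom κ 0 := by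
  classical
  haveI : FiniteDimensional K (κ.layer 1) := κ.finiteDimensional_layer_holds 1
  haveI : NumberField (κ.layer 1) := NumberField.of_module_finite K _
  haveI : IsScalarTower ℤ (𝓞 K) (κ.layer 1) := IsScalarTower.of_algebraMap_eq fun n => by simp
  have hK2 : ¬ 2 ∣ Module.finrank ℚ K := by rw [hK]; norm_num
  obtain ⟨θ, hθ⟩ := exists_sq_eq_two_layer_one_of_not_dvd_finrank hK2 κ hκ
  -- the images of `u, v, m, m'` in `𝓞 L₁` and `L₁`
  set ι := algebraMap (𝓞 K) (𝓞 (κ.layer 1)) with hι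
  set uL : κ.layer 1 := ((ι u : 𝓞 (κ.layer 1)) : κ.layer 1) with huL
  set vL : κ.layer 1 := ((ι v : 𝓞 (κ.layer 1)) : κ.layer 1) with hvL
  set mL : κ.layer 1 := ((ι m : 𝓞 (κ.layer 1)) : κ.layer 1) with hmL
  set m'L : κ.layer 1 := ((ι m' : 𝓞 (κ.layer 1)) : κ.layer 1) with hm'L
  have huvL : uL ^ 2 - 2 * vL ^ 2 = 4 * mL := by
    have := congrArg (fun z : 𝓞 K => ((ι z : 𝓞 (κ.layer 1)) : κ.layer 1)) huv
    simp only [map_sub, map_mul, map_pow, map_ofNat] at this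
    exact this
  have hmL2 : mL ^ 2 = 2 * m'L := by
    have := congrArg (fun z : 𝓞 K => ((ι z : 𝓞 (κ.layer 1)) : κ.layer 1)) hm
    simp only [map_mul, map_pow, map_ofNat] at this
    exact this
  -- the certificate elements `x = (u + vθ)/2`, `y = x²θ/2`
  set x : κ.layer 1 := (uL + vL * θ) / 2 with hxdef
  set y : κ.layer 1 := x ^ 2 * θ / 2 with hydef
  have hx : x ^ 2 - uL * x + mL = 0 := by
    rw [hxdef]; field_simp; linear_combination vL ^ 2 * hθ - huvL
  have hy : y ^ 2 - (uL * vL) * y - m'L = 0 := by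
    rw [hydef, hxdef]; field_simp
    linear_combination (uL ^ 4 + 4 * uL ^ 3 * vL * θ + 6 * uL ^ 2 * vL ^ 2 * (θ ^ 2 + 2) +
      4 * uL * vL ^ 3 * θ * (θ ^ 2 + 2) + vL ^ 4 * (θ ^ 4 + 2 * θ ^ 2 + 4) - 16 * uL ^ 2 * vL ^ 2 -
      8 * uL * vL ^ 3 * θ) * hθ + 2 * (uL ^ 2 - 2 * vL ^ 2 + 4 * mL) * huvL + 32 * hmL2
  have hxy : x ^ 2 = θ * y := by
    rw [hydef]; field_simp; linear_combination (-(x ^ 2)) * hθ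
  -- integrality of `θ`, `x`, `y` (monic quadratics over `𝓞 K`)
  have hθint : IsIntegral ℤ θ := ⟨X ^ 2 - C 2, monic_X_pow_sub_C _ two_ne_zero, by simp [hθ]⟩
  have halg : ∀ z : 𝓞 K, algebraMap (𝓞 K) (κ.layer 1) z = ((ι z : 𝓞 (κ.layer 1)) : κ.layer 1) :=
    fun z => IsScalarTower.algebraMap_apply (𝓞 K) (𝓞 (κ.layer 1)) (κ.layer 1) z
  have hxint : IsIntegral ℤ x := by
    refine isIntegral_trans (R := ℤ) (A := 𝓞 K) x ⟨X ^ 2 - C u * X + C m, by monicity <;> norm_num, ?_⟩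
    simp only [eval₂_add, eval₂_sub, eval₂_mul, eval₂_X_pow, eval₂_C, eval₂_X, halg]
    exact hx
  have hyint : IsIntegral ℤ y := by
    refine isIntegral_trans (R := ℤ) (A := 𝓞 K) y ⟨X ^ 2 - C (u * v) * X - C m', by monicity <;> norm_num, ?_⟩
    simp only [eval₂_sub, eval₂_mul, eval₂_X_pow, eval₂_C, eval₂_X, map_mul, halg]
    exact hy
  set θ' : 𝓞 (κ.layer 1) := ⟨θ, hθint⟩ with hθ'def
  set x' : 𝓞 (κ.layer 1) := ⟨x, hxint⟩ with hx'def
  set y' : 𝓞 (κ.layer 1) := ⟨y, hyint⟩ with hy'def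
  have hθ' : θ' ^ 2 = 2 := by
    apply Subtype.ext; change ((θ' ^ 2 : 𝓞 (κ.layer 1)) : κ.layer 1) = ((2 : 𝓞 (κ.layer 1)) : κ.layer 1)
    push_cast; exact hθ
  have hx' : x' ^ 2 = θ' * y' := by
    apply Subtype.ext
    change ((x' ^ 2 : 𝓞 (κ.layer 1)) : κ.layer 1) = ((θ' * y' : 𝓞 (κ.layer 1)) : κ.layer 1)
    push_cast; exact hxy
  have hy' : y' * (ι (u * v) - y') = -(ι m') := by
    apply Subtype.ext
    change ((y' * (ι (u * v) - y') : 𝓞 (κ.layer 1)) : κ.layer 1) = ((-(ι m') : 𝓞 (κ.layer 1)) : κ.layer 1)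
    rw [map_mul]
    push_cast
    change y * (uL * vL - y) = -m'L
    linear_combination (-1 : κ.layer 1) * hy
  -- a prime `Q ∋ 2` of `𝓞 L₁` missing `y'`
  obtain ⟨Q, hQprime, h2Q, hyQ⟩ : ∃ Q : Ideal (𝓞 (κ.layer 1)), Q.IsPrime ∧ (2 : 𝓞 (κ.layer 1)) ∈ Q ∧ y' ∉ Q := by
    by_contra hall
    push Not at hall
    have hm' : ∀ w : Ideal (𝓞 K), w.IsPrime → (2 : 𝓞 K) ∈ w → m' ∈ w :=
      fun w hw hw2 => mem_of_forall_mem_of_mul_eq hy' hall w hw2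
    have h3 : m' ^ 3 ∈ Ideal.span {(2 : 𝓞 K)} := by
      have := pow_finrank_mem_span_two_of_forall_mem hm'
      rwa [hK] at this
    exact hN (eight_dvd_norm_of_mem_span_two hK
      (Ideal.sub_mem _ (Ideal.mem_span_singleton_self _) h3))
  haveI := hQprime
  have h4 := four_dvd_ramificationIdx_of_sq_eq_mul hθ' hx' Q h2Q hyQ
  obtain ⟨hw₀, hQw₀⟩ := ramificationIdx_eq_two_of_four_dvd hK κ Q h2Q h4
  -- conclusion via the first-layer criterion
  haveI := isMaximal_span_two
  have h20 : (Ideal.span {(2 : ℤ)} : Ideal ℤ) ≠ ⊥ := by simp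
  refine totallyRamifiedFrom_zero_of_forall_not_isUnramifiedIn_layer_one κ fun w hw2 hunr => ?_
  rcases Nat.even_or_odd (w.asIdeal.ramificationIdx ℤ) with heven | hodd
  · -- `w` has even index: it is the prime below `Q`
    haveI : w.asIdeal.IsPrime := w.isPrime
    have hw2' : (2 : 𝓞 K) ∈ w.asIdeal := by exact_mod_cast hw2
    haveI hwl : w.asIdeal.LiesOver (Ideal.span {(2 : ℤ)}) := by
      rw [Ideal.liesOver_span_iff w.isPrime.ne_top Int.prime_two, map_ofNat]; exact hw2'
    have hu2 : (2 : 𝓞 K) ∈ Q.under (𝓞 K) := by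
      rw [Ideal.under_def, Ideal.mem_comap, map_ofNat]; exact h2Q
    haveI hul : (Q.under (𝓞 K)).LiesOver (Ideal.span {(2 : ℤ)}) := by
      rw [Ideal.liesOver_span_iff Ideal.IsPrime.ne_top' Int.prime_two, map_ofNat]; exact hu2
    have heq : w.asIdeal = Q.under (𝓞 K) := by
      by_contra hne
      have hsum := Ideal.sum_ramification_inertia (R := ℤ) (𝓞 K) ℚ K (p := Ideal.span {(2 : ℤ)}) h20
      rw [hK] at hsum
      have hmemw : w.asIdeal ∈ IsDedekindDomain.primesOverFinset (Ideal.span {(2 : ℤ)}) (𝓞 K) :=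
        (IsDedekindDomain.mem_primesOverFinset_iff h20 _).mpr ⟨w.isPrime, hwl⟩
      have hmemu : Q.under (𝓞 K) ∈ IsDedekindDomain.primesOverFinset (Ideal.span {(2 : ℤ)}) (𝓞 K) :=
        (IsDedekindDomain.mem_primesOverFinset_iff h20 _).mpr ⟨inferInstance, hul⟩
      have hsub : ({w.asIdeal, Q.under (𝓞 K)} : Finset (Ideal (𝓞 K))) ⊆
          IsDedekindDomain.primesOverFinset (Ideal.span {(2 : ℤ)}) (𝓞 K) := by
        intro P hP
        rcases Finset.mem_insert.mp hP with rfl | hP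
        · exact hmemw
        · rw [Finset.mem_singleton.mp hP]; exact hmemu
      have hle := Finset.sum_le_sum_of_subset (f := fun P =>
        Ideal.ramificationIdx' (Ideal.span {(2 : ℤ)}) P * Ideal.inertiaDeg' (Ideal.span {(2 : ℤ)}) P) hsub
      rw [Finset.sum_pair hne, hsum] at hle
      -- `e'(w) ≥ 2`, `e'(under Q) = 2`, `f' ≥ 1`
      have hew : Ideal.ramificationIdx' (Ideal.span {(2 : ℤ)}) w.asIdeal = w.asIdeal.ramificationIdx ℤ :=
        Ideal.ramificationIdx'_eq_ramificationIdx _ _ h20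
      have heu : Ideal.ramificationIdx' (Ideal.span {(2 : ℤ)}) (Q.under (𝓞 K)) = 2 := by
        rw [Ideal.ramificationIdx'_eq_ramificationIdx _ _ h20, hw₀]
      have hfw := Ideal.inertiaDeg'_pos (Ideal.span {(2 : ℤ)}) w.asIdeal
      have hfu := Ideal.inertiaDeg'_pos (Ideal.span {(2 : ℤ)}) (Q.under (𝓞 K))
      have hewpos : 0 < w.asIdeal.ramificationIdx ℤ := Ideal.ramificationIdx_pos _ ℤ
      obtain ⟨k, hk⟩ := heven
      simp only [hew, heu] at hle
      have hk1 : 1 ≤ k := by omega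
      nlinarith
    haveI : Q.LiesOver w.asIdeal := by rw [heq]; exact ⟨rfl⟩
    have h1 := hunr.ramificationIdx_eq_one (𝔓 := Q) ‹_›
    omega
  · exact not_isUnramifiedIn_layer_one_of_odd_ramificationIdx hK2 κ hκ hw2 hodd hunr

end Main

end Literature.NumberTheory.IwasawaTheory

end
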